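import Literature.AlgebraicGeometry.HodgeTheory.UnitaryReflectionGroupZariskiDense
import HarnessLib

/-!
# No twist-isomorphisms between complex reflections with different multipliers: the eigenvalue
# dichotomy `λ = λ'` or `λλ' = 1` (Katz 1990, Prop. 1.8.2, hypotheses (3)–(4), discharged for
# Carlson–Toledo's reflection groups) — lane D, hole (e)

Family `hodge`, layer `Literature/AlgebraicGeometry/HodgeTheory`. THEOREMS only, for crux K1 of
`Summits/HodgeConjecture/HodgeConjecture/Theses/CyclicUnitaryPowers.lean` (lane D glue, holes S4/S5 of the
skeleton: hypotheses (3)–(4) of `Katz1990_goursatKolchinRibet_specialLinear'` for the monodromy group, whose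
`i`-th projections of a generator are complex `ζ^i`-reflections).  Complement of `PseudoReflectionTwist`
(which treats `dim ≥ 3` by ranks); the argument here is by EIGENVALUES and holds in every dimension `≥ 2`:
* `eigenvalue_complexReflection` — an eigenvalue of `s^{λ'}_{δ'}` is `1` or `λ'`;
* `twist_eigenvalue_dichotomy` — if `A R A⁻¹ = χ R'` where `R` has an eigenvector of eigenvalue `λ ∉ {0,1}`
  and a non-zero fixed vector, and every eigenvalue of `R'` is `1` or `λ' ≠ 0`, then `λ = λ'` or `λλ' = 1`;
* `twist_complexReflection_dichotomy` — (3): a twist-isomorphism `A s^λ_δ = χ s^{λ'}_{δ'} A` (`dim ≥ 2`)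
  forces `λ = λ'` or `λλ' = 1`;
* `twist_dualMap_symm_complexReflection_dichotomy` — (4): the same for the contragredient
  `A (s^λ_δ)⁻ᵗ = χ s^{λ'}_{δ'} A`.
For `λ = ζ^a`, `λ' = ζ^b` with `1 ≤ a ≠ b ≤ (p−1)/2` both alternatives fail, which is how the glue uses them.
Written by the prover seat `hodge-nonav-prover-Ax`.

## References
* [Katz1990ESDE] N. M. Katz, *Exponential Sums and Differential Equations*, Annals of Math. Studies 124 (1990),
  §1.8 Prop. 1.8.2 (hypotheses (3), (4)).
* [CarlsonToledo1999] J. A. Carlson, D. Toledo, Duke Math. J. 97 (1999), §6 Proposition 2, §7 (p. 16).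
-/

noncomputable section

open Module

namespace Literature.AlgebraicGeometry.HodgeTheory

/-! ### §1 The abstract dichotomy -/

section Abstract

universe u v w

variable {K : Type u} [Field K] {W : Type v} [AddCommGroup W] [Module K W] {W' : Type w} [AddCommGroup W']
  [Module K W']

/-- **Eigenvalue dichotomy for twist-isomorphisms.**  Let `A : W ≃ W'`, `A ∘ R = χ • (R' ∘ A)`; suppose `R`
has an eigenvector with eigenvalue `λ ∉ {0, 1}` and a non-zero fixed vector, and every eigenvalue of `R'` is
`1` or `λ'`, `λ' ≠ 0`.  Then `λ = λ'` or `λ λ' = 1`.  (Reading eigenvalues through `A`: `χ⁻¹` and `λ/χ` are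
eigenvalues of `R'`.) [cite: Katz1990ESDE, §1.8 Prop. 1.8.2] -/
theorem twist_eigenvalue_dichotomy {R : W →ₗ[K] W} {R' : W' →ₗ[K] W'} {l l' χ : K} (A : W ≃ₗ[K] W')
    (hA : (A : W →ₗ[K] W') ∘ₗ R = χ • (R' ∘ₗ (A : W →ₗ[K] W')))
    (hδ : ∃ δ : W, δ ≠ 0 ∧ R δ = l • δ) (hfix : ∃ x : W, x ≠ 0 ∧ R x = x)
    (hR' : ∀ (μ : K) (y : W'), y ≠ 0 → R' y = μ • y → μ = 1 ∨ μ = l')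
    (hl1 : l ≠ 1) (hl0 : l ≠ 0) (hl'0 : l' ≠ 0) : l = l' ∨ l * l' = 1 := by
  obtain ⟨δ, hδ0, hRδ⟩ := hδ
  obtain ⟨x, hx0, hRx⟩ := hfix
  have hAR : ∀ v, A (R v) = χ • R' (A v) := fun v => by
    simpa using congrArg (fun f : W →ₗ[K] W' => f v) hA
  -- `χ ≠ 0`
  have hχ : χ ≠ 0 := by
    intro hχ
    have h := hAR δ
    rw [hRδ, hχ, zero_smul, map_smul, smul_eq_zero] at h
    exact hl0 (h.resolve_right (by simpa using hδ0))
  -- `R' (A x) = χ⁻¹ A x` and `R' (A δ) = (l χ⁻¹) A δ`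
  have h1 : R' (A x) = χ⁻¹ • A x := by
    have h := hAR x
    rw [hRx] at h
    calc R' (A x) = χ⁻¹ • (χ • R' (A x)) := by rw [smul_smul, inv_mul_cancel₀ hχ, one_smul]
      _ = χ⁻¹ • A x := by rw [← h]
  have h2 : R' (A δ) = (l * χ⁻¹) • A δ := by
    have h := hAR δ
    rw [hRδ, map_smul] at h
    calc R' (A δ) = χ⁻¹ • (χ • R' (A δ)) := by rw [smul_smul, inv_mul_cancel₀ hχ, one_smul]
      _ = χ⁻¹ • (l • A δ) := by rw [h]
      _ = (l * χ⁻¹) • A δ := by rw [smul_smul, mul_comm]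
  have hAx : A x ≠ 0 := by simpa using hx0
  have hAδ : A δ ≠ 0 := by simpa using hδ0
  rcases hR' _ _ hAx h1 with hχ1 | hχl
  · -- `χ = 1`: then `l` is an eigenvalue of `R'`, so `l = λ'`
    have hχ1' : χ = 1 := inv_eq_one.mp hχ1
    rw [hχ1', inv_one, mul_one] at h2
    rcases hR' _ _ hAδ h2 with h | h
    · exact absurd h hl1
    · exact Or.inl h
  · -- `χ⁻¹ = λ'`: then `l λ'` is an eigenvalue of `R'`
    rw [hχl] at h2
    rcases hR' _ _ hAδ h2 with h | h
    · exact Or.inr h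
    · -- `l λ' = λ'` forces `l = 1`
      exfalso
      apply hl1
      have : (l - 1) * l' = 0 := by rw [sub_mul, one_mul, h, sub_self]
      exact sub_eq_zero.mp ((mul_eq_zero.mp this).resolve_right hl'0)

end Abstract

/-! ### §2 Eigen-data of complex reflections -/

section Reflection

variable {W : Type} [AddCommGroup W] [Module ℂ W] {W' : Type} [AddCommGroup W'] [Module ℂ W']

/-- **The eigenvalues of a complex `λ`-reflection are `1` and `λ`**: if `s_δ y = μ y`, `y ≠ 0`
(`h(δ,δ) = ε`, `ε² = 1`) then `μ = 1` or `μ = λ`. [cite: CarlsonToledo1999, §6 Proposition 2] -/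
theorem eigenvalue_complexReflection (B : W →ₗ⋆[ℂ] W →ₗ[ℂ] ℂ) {ε : ℂ} (hε : ε * ε = 1) (l : ℂ) {δ : W}
    (hδ : B δ δ = ε) (μ : ℂ) (y : W) (hy : y ≠ 0) (h : complexReflection B ε l δ y = μ • y) :
    μ = 1 ∨ μ = l := by
  rw [complexReflection_apply] at h
  by_cases hc : ε * (l - 1) * B δ y = 0
  · left
    rw [hc, zero_smul, add_zero] at h
    -- `y = μ y`, `y ≠ 0`
    have : (μ - 1) • y = 0 := by rw [sub_smul, one_smul, ← h, sub_self]
    exact (sub_eq_zero.mp ((smul_eq_zero.mp this).resolve_right hy)).symm ▸ rfl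
  · right
    -- `(μ - 1) y = c δ` with `c ≠ 0`: apply `B δ` to get `(μ - 1) B δ y = c ε`, whence `μ - 1 = λ - 1`
    have hy' : (μ - 1) • y = (ε * (l - 1) * B δ y) • δ := by rw [sub_smul, one_smul, ← h, add_sub_cancel_left]
    have hB := congrArg (B δ) hy'
    rw [map_smul, map_smul, smul_eq_mul, smul_eq_mul, hδ] at hB
    have hBy : B δ y ≠ 0 := fun h0 => hc (by rw [h0, mul_zero])
    -- `(μ - 1) B δ y = ε (λ - 1) B δ y ε = (λ - 1) B δ y`
    have : (μ - 1 - (l - 1)) * B δ y = 0 := by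
      have hε' : ε * (l - 1) * B δ y * ε = (l - 1) * B δ y := by linear_combination ((l - 1) * B δ y) * hε
      rw [sub_mul, hB, hε', sub_self]
    have h3 := (mul_eq_zero.mp this).resolve_right hBy
    linear_combination h3

/-- A complex reflection has the root as eigenvector (`s_δ δ = λ δ`, `δ ≠ 0` as `h(δ,δ) = ε ≠ 0`) and, if
`dim W ≥ 2`, a non-zero fixed vector (in `δ^⊥ = ker h(δ, ·)`). [cite: CarlsonToledo1999, §6 Proposition 2] -/
theorem exists_eigenvector_and_fixed_complexReflection [FiniteDimensional ℂ W] (h2 : 2 ≤ finrank ℂ W)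
    (B : W →ₗ⋆[ℂ] W →ₗ[ℂ] ℂ) {ε : ℂ} (hε : ε * ε = 1) (l : ℂ) {δ : W} (hδ : B δ δ = ε) :
    (∃ v : W, v ≠ 0 ∧ complexReflection B ε l δ v = l • v) ∧
      ∃ x : W, x ≠ 0 ∧ complexReflection B ε l δ x = x := by
  have hε0 : ε ≠ 0 := fun h => by rw [h, mul_zero] at hε; exact zero_ne_one hε
  have hδ0 : δ ≠ 0 := fun h => hε0 (by rw [← hδ, h]; simp)
  refine ⟨⟨δ, hδ0, complexReflection_apply_self B hε l hδ⟩, ?_⟩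
  -- `ker (B δ)` is non-trivial: `dim range ≤ 1 < 2 ≤ dim W`
  have hker : LinearMap.ker (B δ) ≠ ⊥ := by
    intro hbot
    have hsum := LinearMap.finrank_range_add_finrank_ker (B δ)
    rw [hbot, finrank_bot, add_zero] at hsum
    have hle : finrank ℂ (LinearMap.range (B δ)) ≤ 1 :=
      (Submodule.finrank_le _).trans (by rw [Module.finrank_self])
    omega
  obtain ⟨x, hx, hx0⟩ := (Submodule.ne_bot_iff _).1 hker
  exact ⟨x, hx0, complexReflection_apply_of_orthogonal B ε l (LinearMap.mem_ker.1 hx)⟩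

/-- **Hypothesis (3) for reflection generators.**  A twist-isomorphism `A ∘ s^λ_δ = χ • s^{λ'}_{δ'} ∘ A`
between complex reflections (`dim W ≥ 2`; unit roots of signs `ε, ε'`; `λ ∉ {0,1}`, `λ' ≠ 0`) forces
`λ = λ'` or `λλ' = 1`. [cite: Katz1990ESDE, §1.8 Prop. 1.8.2] [cite: CarlsonToledo1999, §7 (p. 16)] -/
theorem twist_complexReflection_dichotomy [FiniteDimensional ℂ W] (h2 : 2 ≤ finrank ℂ W)
    (B : W →ₗ⋆[ℂ] W →ₗ[ℂ] ℂ) (B' : W' →ₗ⋆[ℂ] W' →ₗ[ℂ] ℂ) {ε ε' : ℂ} (hε : ε * ε = 1) (hε' : ε' * ε' = 1)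
    {l l' : ℂ} (hl1 : l ≠ 1) (hl0 : l ≠ 0) (hl'0 : l' ≠ 0) {δ : W} {δ' : W'} (hδ : B δ δ = ε)
    (hδ' : B' δ' δ' = ε') (A : W ≃ₗ[ℂ] W') {χ : ℂ}
    (hA : (A : W →ₗ[ℂ] W') ∘ₗ complexReflection B ε l δ = χ • (complexReflection B' ε' l' δ' ∘ₗ (A : W →ₗ[ℂ] W'))) :
    l = l' ∨ l * l' = 1 := by
  obtain ⟨hv, hx⟩ := exists_eigenvector_and_fixed_complexReflection h2 B hε l hδ
  exact twist_eigenvalue_dichotomy A hA hv hx (fun μ y hy h => eigenvalue_complexReflection B' hε' l' hδ' μ y hy h)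
    hl1 hl0 hl'0

/-! ### §3 The contragredient: hypothesis (4) -/

/-- The inverse of the automorphism `s^λ_δ` (`λ ≠ 0`) acts as `s^{λ⁻¹}_δ`. [cite: CarlsonToledo1999, §7 (p. 16)] -/
theorem symm_apply_of_coe_eq_complexReflection (B : W →ₗ⋆[ℂ] W →ₗ[ℂ] ℂ) {ε : ℂ} (hε : ε * ε = 1) {l : ℂ}
    (hl0 : l ≠ 0) {δ : W} (hδ : B δ δ = ε) {s : W ≃ₗ[ℂ] W} (hs : (s : W →ₗ[ℂ] W) = complexReflection B ε l δ)
    (y : W) : s.symm y = complexReflection B ε l⁻¹ δ y := by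
  apply s.injective
  rw [LinearEquiv.apply_symm_apply]
  have h := congrArg (fun f : W →ₗ[ℂ] W => f y) (complexReflection_comp B hε l l⁻¹ hδ)
  simp only [LinearMap.coe_comp, Function.comp_apply, mul_inv_cancel₀ hl0, complexReflection_one,
    LinearMap.id_apply] at h
  show y = (s : W →ₗ[ℂ] W) (complexReflection B ε l⁻¹ δ y)
  rw [hs, h]

/-- Eigen-data of the contragredient `(s^λ_δ)⁻ᵗ` on the dual space: the functional `h(δ, ·)` is an
eigenvector with eigenvalue `λ⁻¹`, and any non-zero functional vanishing at `δ` (which exists when `dim ≥ 2`)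
is fixed. [cite: Katz1990ESDE, §1.8 Prop. 1.8.2] [cite: CarlsonToledo1999, §7 (p. 16)] -/
theorem exists_eigenvector_and_fixed_dualMap_symm [FiniteDimensional ℂ W] (h2 : 2 ≤ finrank ℂ W)
    (B : W →ₗ⋆[ℂ] W →ₗ[ℂ] ℂ) {ε : ℂ} (hε : ε * ε = 1) {l : ℂ} (hl0 : l ≠ 0) {δ : W} (hδ : B δ δ = ε)
    {s : W ≃ₗ[ℂ] W} (hs : (s : W →ₗ[ℂ] W) = complexReflection B ε l δ) :
    (∃ φ : Module.Dual ℂ W, φ ≠ 0 ∧ (s.symm : W →ₗ[ℂ] W).dualMap φ = l⁻¹ • φ) ∧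
      ∃ ψ : Module.Dual ℂ W, ψ ≠ 0 ∧ (s.symm : W →ₗ[ℂ] W).dualMap ψ = ψ := by
  have hε0 : ε ≠ 0 := fun h => by rw [h, mul_zero] at hε; exact zero_ne_one hε
  have hδ0 : δ ≠ 0 := fun h => hε0 (by rw [← hδ, h]; simp)
  constructor
  · refine ⟨B δ, fun h0 => hε0 (by rw [← hδ, h0, LinearMap.zero_apply]), ?_⟩
    refine LinearMap.ext fun y => ?_
    rw [LinearMap.dualMap_apply, LinearMap.smul_apply, LinearEquiv.coe_coe,
      symm_apply_of_coe_eq_complexReflection B hε hl0 hδ hs, complexReflection_apply, map_add, map_smul, hδ,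
      smul_eq_mul, smul_eq_mul]
    linear_combination (B δ y * (l⁻¹ - 1)) * hε
  · -- a non-zero functional vanishing at `δ`: the annihilator of `ℂ δ` is non-trivial since `dim W ≥ 2`
    have hex : ∃ ψ : Module.Dual ℂ W, ψ ≠ 0 ∧ ψ δ = 0 := by
      -- extend `δ` to a basis-free argument: `dim (Dual W) = dim W ≥ 2 > 1 ≥ dim` of functionals modulo `δ^0`…
      -- concretely: the evaluation `Dual W → ℂ, ψ ↦ ψ δ` has kernel of dimension `≥ dim W - 1 ≥ 1`
      let ev : Module.Dual ℂ W →ₗ[ℂ] ℂ := LinearMap.applyₗ δ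
      have hker : LinearMap.ker ev ≠ ⊥ := by
        intro hbot
        have hsum := LinearMap.finrank_range_add_finrank_ker ev
        rw [hbot, finrank_bot, add_zero, Subspace.dual_finrank_eq] at hsum
        have hle : finrank ℂ (LinearMap.range ev) ≤ 1 :=
          (Submodule.finrank_le _).trans (by rw [Module.finrank_self])
        omega
      obtain ⟨ψ, hψ, hψ0⟩ := (Submodule.ne_bot_iff _).1 hker
      exact ⟨ψ, hψ0, LinearMap.mem_ker.1 hψ⟩
    obtain ⟨ψ, hψ0, hψδ⟩ := hex
    refine ⟨ψ, hψ0, LinearMap.ext fun y => ?_⟩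
    rw [LinearMap.dualMap_apply, LinearEquiv.coe_coe, symm_apply_of_coe_eq_complexReflection B hε hl0 hδ hs,
      complexReflection_apply, map_add, map_smul, hψδ, smul_zero, add_zero]

/-- **Hypothesis (4) for reflection generators.**  A twist-isomorphism between the CONTRAGREDIENT of a complex
`λ`-reflection and a complex `λ'`-reflection, `A ∘ (s^λ_δ)⁻ᵗ = χ • s^{λ'}_{δ'} ∘ A` with
`A : W^* ≃ W'` (`dim W ≥ 2`, `λ ∉ {0,1}`, `λ' ≠ 0`), forces `λλ' = 1` or `λ = λ'`.
[cite: Katz1990ESDE, §1.8 Prop. 1.8.2] [cite: CarlsonToledo1999, §7 (p. 16)] -/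
theorem twist_dualMap_symm_complexReflection_dichotomy [FiniteDimensional ℂ W] (h2 : 2 ≤ finrank ℂ W)
    (B : W →ₗ⋆[ℂ] W →ₗ[ℂ] ℂ) (B' : W' →ₗ⋆[ℂ] W' →ₗ[ℂ] ℂ) {ε ε' : ℂ} (hε : ε * ε = 1) (hε' : ε' * ε' = 1)
    {l l' : ℂ} (hl1 : l ≠ 1) (hl0 : l ≠ 0) (hl'0 : l' ≠ 0) {δ : W} {δ' : W'} (hδ : B δ δ = ε)
    (hδ' : B' δ' δ' = ε') {s : W ≃ₗ[ℂ] W} (hs : (s : W →ₗ[ℂ] W) = complexReflection B ε l δ)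
    (A : Module.Dual ℂ W ≃ₗ[ℂ] W') {χ : ℂ}
    (hA : (A : Module.Dual ℂ W →ₗ[ℂ] W') ∘ₗ (s.symm : W →ₗ[ℂ] W).dualMap =
      χ • (complexReflection B' ε' l' δ' ∘ₗ (A : Module.Dual ℂ W →ₗ[ℂ] W'))) :
    l * l' = 1 ∨ l = l' := by
  obtain ⟨hv, hx⟩ := exists_eigenvector_and_fixed_dualMap_symm h2 B hε hl0 hδ hs
  have h := twist_eigenvalue_dichotomy A hA hv hx
    (fun μ y hy h => eigenvalue_complexReflection B' hε' l' hδ' μ y hy h) (fun h => hl1 (inv_eq_one.mp h))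
    (inv_ne_zero hl0) hl'0
  rcases h with h | h
  · left
    rw [← h, mul_inv_cancel₀ hl0]
  · right
    exact ((eq_inv_of_mul_eq_one_right h).trans (inv_inv l)).symm

end Reflection

end Literature.AlgebraicGeometry.HodgeTheory

end
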